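/-
Copyright (c) 2026. All rights reserved.
Released under Apache 2.0 license as described in the file LICENSE.
Authors: abc-iut cell, seat abc-iut-L4-t10 (gen 5; block W2-B4 model-column coda «COR45-FULL-UNIFORMISED»:
Corollary 4.5 with ALL its printed clauses at the uniformised bases `X₀ = ℍ/Γ̄` and at GENUINE compact
hyperbolic Riemann surfaces — consumer of abc-iut-L4-t14's and abc-iut-w6-d031's columns, by name).
-/
import Literature.AnabelianGeometry.AbsoluteAnabelian.AbsTopIII.AutHolLogFrobeniusCor45FullModelClosers
import Literature.AnabelianGeometry.AbsoluteAnabelian.ArchimedeanHolFieldFunctorGeometricPSLSurface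
import Literature.AnabelianGeometry.AbsoluteAnabelian.ArchimedeanHolFieldFunctorGeometricPSLUniformisedBaseFree
import HarnessLib

/-!
# [AbsTopIII] Cor 4.5 with ALL printed clauses at the uniformised bases `ℍ/Γ̄`, and Prop 4.2 (i) /
# Cor 4.5 at a GENUINE compact hyperbolic Riemann surface (PROOF-ONLY)

S. Mochizuki, *Topics in Absolute Anabelian Geometry III*, Prop 4.2 (i) proof p.106 l.11–19 («… the
id-rigidity of `EA` follows immediately from the slimness assertion of Lemma 4.3»), Cor 4.5 pp.107–110
(kurims manuscript, lit key `paper:url-5493eb38cbb7`; bib key `MochizukiAbsTopIII2015`).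

Seat abc-iut-L4-t10's capstone `AbsTopIII.cor_4_5_full_arch_iff_cor_4_5` (p459467) makes EVERY printed
clause of Cor 4.5 — items (i)–(v) and the three compatibility sentences of (iii)/(v), the conjunction
`AbsTopIII.Cor_4_5_full` — equivalent to `AbsTopIII.Cor_4_5` at the archimedean model of any interface
datum `𝔄`.  This coda feeds it the new uniformised bases of the geometric column:

* abc-iut-L4-t14 (gen 5, p461952 `…PSLSurface`): `X₀ = ℍ/Γ̄` for `Γ̄ ≤ PSL₂(ℝ)` free of finite rank or an
  orientable surface group, non-abelian, acting freely and properly discontinuously — hypotheses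
  {`hfin`, `hN`}; and the COCOMPACT column, where both residuals are DISCHARGED;
* abc-iut-L4-t14 (gen 4, p449027 `…PSLSlim`, p456078 `…RCPSLIdRigid`): `Γ̄` free of rank `≥ 2`,
  holomorphic morphisms {`hfin`, `hN`} and print-faithful RC-morphisms {`hfin`, `hN′`};
* abc-iut-w6-d031 (gen 4, p459597/p461685 `…PSLUniformisedBase(Free)`): the junction `pslQuotient Λ̄ ≅ X`
  for a Riemann surface `X` holomorphically covered by `ℍ`, with `π₁(X) ≃* Λ̄` and the transport equality
  «maps to `ℍ/Λ̄`» = «maps to `X`».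

Results (no definition, no instance, no named fact):

* `HolRS.cor_4_5_full_geometric_mapsTo_pslQuotient_of_isFreeOrSurface` / `…_of_isFreeGroup` /
  `HolRS.RC.cor_4_5_full_geometric_mapsTo_pslQuotient_of_isFreeGroup` — `Cor_4_5_full` over the geometric
  `EA` of «objects mapping to `ℍ/Γ̄`», hypotheses {`hfin`, `hN`} (resp. {`hfin`, `hN′`});
* ★ `HolRS.cor_4_5_full_geometric_mapsTo_pslQuotient_of_compactSpace` / `…_of_isOrientableSurfaceGroup`,
  `HolRS.isIdRigid_pairs_mapsTo_pslQuotient_of_isOrientableSurfaceGroup` — **for a COMPACT uniformised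
  base `X₀ = ℍ/Γ̄` (`Γ̄` an orientable surface group acting freely, properly discontinuously, cocompactly):
  `Cor_4_5_full` and the Prop 4.2 (i) id-rigidity of `𝒞^hol_TF`, `𝒞^hol_T` — NO residual hypothesis**;
* ★★ `HolRS.isIdRigid_EA_and_cor_4_5_full_mapsTo_of_cover_of_isOrientableSurfaceGroup` — **at a GENUINE
  compact Riemann surface `X` holomorphically covered by `ℍ` whose fundamental group is an orientable
  surface group: the geometric `EA` of «objects mapping to `X`» is ID-RIGID (Prop 4.2 (i)) and
  `Cor_4_5_full` holds — NO residual hypothesis** (uniformise by abc-iut-w6-d031's junction, transport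
  cocompactness and the surface-group property along `pslQuotient Λ̄ ≅ X`, `π₁(X) ≃* Λ̄`, apply the
  cocompact column, transport back);
* `HolRS.isIdRigid_EA_and_cor_4_5_full_mapsTo_of_isOrientableSurfaceGroup_fundamentalGroup` — the same for
  EVERY compact second-countable Riemann surface with surface-group `π₁` (every compact hyperbolic
  `X` of genus `≥ 2`), MODULO the one Tier-2 named fact `RiemannSurface.SimplyConnectedUniformization`.

HONEST SCOPE.  MODEL side of [AbsTopIII] §4: model ≠ node-level ≠ reconstruction; holomorphic morphisms
except where `RC` is named; «compact of genus `≥ 2` ⇒ `π₁` is an orientable surface group» is NOT derived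
(the tree does not compute `π₁` of a compact surface) — it is the hypothesis `hπ`; `hfin`/`hN`/`hN′` are
hypotheses where they appear (campaign-L residuals of abc-iut-L4-t14's column); the joint-telecore-witness
caveat F-L4t10g4-1 of `Cor_4_5_full` (two telecore witnesses for (ii)/(v) vs (iii)) stands as filed.
Support library for the NODES wording of `AbsTopIII:Cor4.5` (not a counting node).  Refereed pre-IUT
anabelian geometry; nothing here bears on [IUTchIII] Cor. 3.12 or takes a side; typed ≠ proved.
-/

set_option autoImplicit false

noncomputable section

namespace Literature.AnabelianGeometry.AbsoluteAnabelian

namespace HolRS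

open scoped _root_.Manifold _root_.ContDiff _root_.Topology UpperHalfPlane MatrixGroups
open _root_.MulAction _root_.Function _root_.CategoryTheory
open Matrix.ProjectiveSpecialLinearGroup (toPGL)
open Literature.IUT.HodgeTheaters (IsFreeOrSurface IsOrientableSurfaceGroup)

/-! ### §1 `Cor_4_5_full` over «objects mapping to `ℍ/Γ̄`» -/

section Uniformised

variable (Γ : Subgroup PSL2R) [ProperlyDiscontinuousSMul Γ ℍ] [IsCancelSMul Γ ℍ]
  (hfin : ∀ (g : PSL2R) (Λ₁ Λ₂ : _root_.Literature.AnabelianGeometry.AbsoluteAnabelian.LocObj Γ),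
    (∀ x ∈ Λ₁.toSubgroup, g * x * g⁻¹ ∈ Λ₂.toSubgroup) →
    ((Literature.Geometry.Manifold.QuotientManifold.conjSubgroup g Λ₁.toSubgroup).subgroupOf
      Λ₂.toSubgroup).FiniteIndex)

include hfin in
/-- **`Cor_4_5_full` (Cor 4.5 (i)–(v) with the three compatibility sentences) over the geometric `EA`
of connected Riemann surfaces finite étale over `X₀ = ℍ/Γ̄`**, `Γ̄` free of finite rank or an orientable
surface group, non-abelian, acting freely and properly discontinuously on `ℍ`; hypotheses {`hfin`, `hN`}
(abc-iut-L4-t14's `cor_4_5_geometric_mapsTo_pslQuotient_of_isFreeOrSurface` fed to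
`AbsTopIII.cor_4_5_full_arch_iff_cor_4_5`). [cite: MochizukiAbsTopIII2015, Corollary 4.5 pp.107–109] -/
theorem cor_4_5_full_geometric_mapsTo_pslQuotient_of_isFreeOrSurface (hΓ : IsFreeOrSurface Γ)
    (hab : ∃ a b : Γ, a * b ≠ b * a)
    (hN : ∀ Λ : _root_.Literature.AnabelianGeometry.AbsoluteAnabelian.LocObj Γ,
      (Λ.toSubgroup.subgroupOf (Subgroup.normalizer (Λ.toSubgroup : Set PSL2R))).FiniteIndex) :
    AbsTopIII.Cor_4_5_full
      (archLogFrobeniusData (geometricAutHolFieldFunctor fun Y : HolRS => Nonempty (Y ⟶ pslQuotient Γ)))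
      (archTelecoreData (geometricAutHolFieldFunctor fun Y : HolRS => Nonempty (Y ⟶ pslQuotient Γ))) :=
  (AbsTopIII.cor_4_5_full_arch_iff_cor_4_5 _).mpr
    (cor_4_5_geometric_mapsTo_pslQuotient_of_isFreeOrSurface Γ hfin hΓ hab hN)

include hfin in
/-- **`Cor_4_5_full` over the geometric `EA` over `X₀ = ℍ/Γ̄`, `Γ̄` free of rank `≥ 2`** (Mathlib
`IsFreeGroup` form), hypotheses {`hfin`, `hN`} (abc-iut-L4-t14's
`cor_4_5_geometric_mapsTo_pslQuotient_of_isFreeGroup`). [cite: MochizukiAbsTopIII2015, Corollary 4.5 pp.107–109] -/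
theorem cor_4_5_full_geometric_mapsTo_pslQuotient_of_isFreeGroup [IsFreeGroup Γ]
    [Finite (IsFreeGroup.Generators Γ)] (h2 : 2 ≤ Nat.card (IsFreeGroup.Generators Γ))
    (hN : ∀ Λ : _root_.Literature.AnabelianGeometry.AbsoluteAnabelian.LocObj Γ,
      (Λ.toSubgroup.subgroupOf (Subgroup.normalizer (Λ.toSubgroup : Set PSL2R))).FiniteIndex) :
    AbsTopIII.Cor_4_5_full
      (archLogFrobeniusData (geometricAutHolFieldFunctor fun Y : HolRS => Nonempty (Y ⟶ pslQuotient Γ)))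
      (archTelecoreData (geometricAutHolFieldFunctor fun Y : HolRS => Nonempty (Y ⟶ pslQuotient Γ))) :=
  (AbsTopIII.cor_4_5_full_arch_iff_cor_4_5 _).mpr
    (cor_4_5_geometric_mapsTo_pslQuotient_of_isFreeGroup Γ hfin h2 hN)

include hfin in
/-- **`Cor_4_5_full` over the geometric `EA` with PRINT-FAITHFUL (RC-holomorphic: holomorphic AND
anti-holomorphic finite étale) morphisms over `X₀ = ℍ/Γ̄`**, `Γ̄` free of rank `≥ 2`, hypotheses
{`hfin`, `hN′ : [N_{PGL₂(ℝ)}(Λ̄) : Λ̄] < ∞` for every finite-index `Λ̄ ≤ Γ̄`} (abc-iut-L4-t14's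
`RC.cor_4_5_geometric_mapsTo_pslQuotient_of_isFreeGroup`; Def 4.1 (iii) / Cor 2.3 (i) morphism class).
[cite: MochizukiAbsTopIII2015, Corollary 4.5 pp.107–109] -/
theorem RC.cor_4_5_full_geometric_mapsTo_pslQuotient_of_isFreeGroup [IsFreeGroup Γ]
    [Finite (IsFreeGroup.Generators Γ)] (h2 : 2 ≤ Nat.card (IsFreeGroup.Generators Γ))
    (hN' : ∀ Λ : _root_.Literature.AnabelianGeometry.AbsoluteAnabelian.LocObj Γ,
      ((Λ.toSubgroup.map (toPGL (n := Fin 2) (R := ℝ))).subgroupOf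
        (Subgroup.normalizer ((Λ.toSubgroup.map (toPGL (n := Fin 2) (R := ℝ)) : Subgroup PGL(2, ℝ)) :
          Set PGL(2, ℝ)))).FiniteIndex) :
    AbsTopIII.Cor_4_5_full
      (archLogFrobeniusData
        (geometricAutHolFieldFunctorRC fun Y : RC => Nonempty (Y ⟶ toRC.obj (pslQuotient Γ))))
      (archTelecoreData
        (geometricAutHolFieldFunctorRC fun Y : RC => Nonempty (Y ⟶ toRC.obj (pslQuotient Γ)))) :=
  (AbsTopIII.cor_4_5_full_arch_iff_cor_4_5 _).mpr
    (RC.cor_4_5_geometric_mapsTo_pslQuotient_of_isFreeGroup Γ hfin h2 hN')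

end Uniformised

/-! ### §2 COMPACT uniformised bases: no residual hypothesis -/

section Cocompact

variable (Γ : Subgroup PSL2R) [ProperlyDiscontinuousSMul Γ ℍ] [IsCancelSMul Γ ℍ]
  [CompactSpace (orbitRel.Quotient Γ ℍ)]

/-- ★ **`Cor_4_5_full` over a COMPACT `X₀ = ℍ/Γ̄`**, `Γ̄` free of finite rank or an orientable surface group,
non-abelian, acting freely, properly discontinuously and cocompactly on `ℍ` — NO residual hypothesis
(abc-iut-L4-t14's cocompact column `cor_4_5_geometric_mapsTo_pslQuotient_of_compactSpace`: `hfin` by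
compactness + proper discontinuity, `hN` by abc-iut-L4-d1's `finiteIndex_subgroupOf_normalizer_of_compactSpace`).
[cite: MochizukiAbsTopIII2015, Corollary 4.5 pp.107–109] -/
theorem cor_4_5_full_geometric_mapsTo_pslQuotient_of_compactSpace (hΓ : IsFreeOrSurface Γ)
    (hab : ∃ a b : Γ, a * b ≠ b * a) :
    AbsTopIII.Cor_4_5_full
      (archLogFrobeniusData (geometricAutHolFieldFunctor fun Y : HolRS => Nonempty (Y ⟶ pslQuotient Γ)))
      (archTelecoreData (geometricAutHolFieldFunctor fun Y : HolRS => Nonempty (Y ⟶ pslQuotient Γ))) :=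
  (AbsTopIII.cor_4_5_full_arch_iff_cor_4_5 _).mpr
    (cor_4_5_geometric_mapsTo_pslQuotient_of_compactSpace Γ hΓ hab)

/-- ★ **`Cor_4_5_full` over the compact hyperbolic Riemann surface `X₀ = ℍ/Γ̄`, `Γ̄` an orientable surface
group** acting freely, properly discontinuously and cocompactly — structural data only.
[cite: MochizukiAbsTopIII2015, Corollary 4.5 pp.107–109] -/
theorem cor_4_5_full_geometric_mapsTo_pslQuotient_of_isOrientableSurfaceGroup
    (hΓ : IsOrientableSurfaceGroup Γ) :
    AbsTopIII.Cor_4_5_full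
      (archLogFrobeniusData (geometricAutHolFieldFunctor fun Y : HolRS => Nonempty (Y ⟶ pslQuotient Γ)))
      (archTelecoreData (geometricAutHolFieldFunctor fun Y : HolRS => Nonempty (Y ⟶ pslQuotient Γ))) :=
  (AbsTopIII.cor_4_5_full_arch_iff_cor_4_5 _).mpr
    (cor_4_5_geometric_mapsTo_pslQuotient_of_isOrientableSurfaceGroup Γ hΓ)

/-- ★ **Prop 4.2 (i), id-rigidity clause, over the compact hyperbolic `X₀ = ℍ/Γ̄`**: the categories
`𝒞^hol_TF` and `𝒞^hol_T` (`T ∈ {TM, TLG, TCG}`) of pairs over the geometric `EA` of «objects mapping to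
`ℍ/Γ̄`» are ID-RIGID, `Γ̄` an orientable surface group acting freely, properly discontinuously and
cocompactly — structural data only (abc-iut-L4-t14's `isIdRigid_EA_mapsTo_pslQuotient_of_isOrientableSurfaceGroup`
+ `isIdRigid_pairs_of_isIdRigid_EA`). [cite: MochizukiAbsTopIII2015, Proposition 4.2 (i) p.105] -/
theorem isIdRigid_pairs_mapsTo_pslQuotient_of_isOrientableSurfaceGroup (hΓ : IsOrientableSurfaceGroup Γ)
    {T : ArchPairType} (hT : T.IsMonoidType) :
    IsIdRigid (HolTFPair (geometricAutHolFieldFunctor fun Y : HolRS => Nonempty (Y ⟶ pslQuotient Γ))) ∧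
      IsIdRigid (HolMonoidPair
        (geometricAutHolFieldFunctor fun Y : HolRS => Nonempty (Y ⟶ pslQuotient Γ)) T) :=
  isIdRigid_pairs_of_isIdRigid_EA _ (isIdRigid_EA_mapsTo_pslQuotient_of_isOrientableSurfaceGroup Γ hΓ) hT

end Cocompact

/-! ### §3 GENUINE compact hyperbolic Riemann surfaces -/

section Genuine

variable (X : HolRS)

/-- ★★ **Prop 4.2 (i) and `Cor_4_5_full` at a GENUINE compact Riemann surface holomorphically covered by
`ℍ` whose fundamental group is an orientable surface group — NO residual hypothesis.**  For `X ∈ HolRS`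
with COMPACT carrier, a holomorphic covering map `k : ℍ → X`, and `π₁(X, x₀)` an orientable surface
group (genus `≥ 2`): the geometric `EA` of «objects of `HolRS` mapping to `X`» is ID-RIGID and every
printed clause of Cor 4.5 holds for its archimedean log-Frobenius data.  Proof: abc-iut-w6-d031's junction
(`exists_pslQuotient_iso_of_cover_transport`: Möbius deck group `Λ̄` acting freely and properly
discontinuously, `π₁(X) ≃* Λ̄`, `pslQuotient Λ̄ ≅ X`, «maps to `ℍ/Λ̄`» = «maps to `X`»); `Λ̄` is an
orientable surface group (`IsOrientableSurfaceGroup.of_mulEquiv`); `ℍ/Λ̄` is compact (continuous image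
of `X` under the inverse isomorphism); abc-iut-L4-t14's cocompact column; transport.
[cite: MochizukiAbsTopIII2015, Proposition 4.2 (i) proof p.106]
[cite: MochizukiAbsTopIII2015, Corollary 4.5 pp.107–109] [cite: FarkasKra1992, IV.5.5–IV.5.6] -/
theorem isIdRigid_EA_and_cor_4_5_full_mapsTo_of_cover_of_isOrientableSurfaceGroup
    [CompactSpace X.carrier] {k : ℍ → X.carrier} (hk : IsCoveringMap k)
    (dk : MDifferentiable 𝓘(ℂ, ℂ) 𝓘(ℂ, ℂ) k) (x₀ : X.carrier)
    (hπ : IsOrientableSurfaceGroup (FundamentalGroup X.carrier x₀)) :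
    IsIdRigid (geometricAutHolFieldFunctor fun Y : HolRS => Nonempty (Y ⟶ X)).EA ∧
      AbsTopIII.Cor_4_5_full
        (archLogFrobeniusData (geometricAutHolFieldFunctor fun Y : HolRS => Nonempty (Y ⟶ X)))
        (archTelecoreData (geometricAutHolFieldFunctor fun Y : HolRS => Nonempty (Y ⟶ X))) := by
  obtain ⟨Λ, hPD, hC, -, hπΛ, ⟨e⟩, hH, -⟩ := exists_pslQuotient_iso_of_cover_transport X hk dk
  -- the Möbius deck group is an orientable surface group
  obtain ⟨φ⟩ := hπΛ x₀
  have hΛ : IsOrientableSurfaceGroup Λ := IsOrientableSurfaceGroup.of_mulEquiv φ.symm hπ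
  -- `ℍ/Λ̄` is compact: the inverse isomorphism is a continuous surjection from the compact `X`
  have hl : LeftInverse e.inv.toFun e.hom.toFun := fun y => by
    have h := congrArg (fun f : pslQuotient Λ ⟶ pslQuotient Λ => f.toFun y) e.hom_inv_id
    simp only [HolRS.comp_toFun, HolRS.id_toFun, Function.comp_apply, id_eq] at h
    exact h
  haveI : CompactSpace (orbitRel.Quotient Λ ℍ) := by
    refine ⟨?_⟩
    have hK : IsCompact (Set.range e.inv.toFun) := isCompact_range e.inv.mdifferentiable.continuous
    rw [hl.surjective.range_eq] at hK
    exact hK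
  have hE := isIdRigid_EA_mapsTo_pslQuotient_of_isOrientableSurfaceGroup Λ hΛ
  have hC45 := cor_4_5_geometric_mapsTo_pslQuotient_of_isOrientableSurfaceGroup Λ hΛ
  rw [hH] at hE hC45
  exact ⟨hE, (AbsTopIII.cor_4_5_full_arch_iff_cor_4_5 _).mpr hC45⟩

/-- **Prop 4.2 (i) and `Cor_4_5_full` at EVERY compact second-countable Riemann surface whose fundamental
group is an orientable surface group (every compact hyperbolic `X` of genus `≥ 2`), MODULO the one Tier-2
named fact `RiemannSurface.SimplyConnectedUniformization`**: non-abelian `π₁` (abc-iut-L5's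
`FreeOrSurface.exists_noncomm_mem_commutator_surfaceCase`) gives a holomorphic `ℍ`-covering by
abc-iut-w6-d031's `exists_pslQuotient_iso_of_nonabelian_fundamentalGroup`; then the previous theorem.
[cite: MochizukiAbsTopIII2015, Proposition 4.2 (i) proof p.106]
[cite: MochizukiAbsTopIII2015, Corollary 4.5 pp.107–109] [cite: FarkasKra1992, IV.5.5–IV.5.6] -/
theorem isIdRigid_EA_and_cor_4_5_full_mapsTo_of_isOrientableSurfaceGroup_fundamentalGroup
    (H2 : Literature.Geometry.Kaehler.RiemannSurface.SimplyConnectedUniformization)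
    [CompactSpace X.carrier] [SecondCountableTopology X.carrier] (x₀ : X.carrier)
    (hπ : IsOrientableSurfaceGroup (FundamentalGroup X.carrier x₀)) :
    IsIdRigid (geometricAutHolFieldFunctor fun Y : HolRS => Nonempty (Y ⟶ X)).EA ∧
      AbsTopIII.Cor_4_5_full
        (archLogFrobeniusData (geometricAutHolFieldFunctor fun Y : HolRS => Nonempty (Y ⟶ X)))
        (archTelecoreData (geometricAutHolFieldFunctor fun Y : HolRS => Nonempty (Y ⟶ X))) := by
  obtain ⟨a, -, b, -, hab⟩ :=
    Literature.IUT.HodgeTheaters.FreeOrSurface.exists_noncomm_mem_commutator_surfaceCase _ hπ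
  obtain ⟨k, Λ, hPD, hC, hk, dk, -⟩ :=
    exists_pslQuotient_iso_of_nonabelian_fundamentalGroup X H2 x₀ ⟨a, b, hab⟩
  exact X.isIdRigid_EA_and_cor_4_5_full_mapsTo_of_cover_of_isOrientableSurfaceGroup hk dk x₀ hπ

end Genuine

end HolRS

end Literature.AnabelianGeometry.AbsoluteAnabelian

end
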